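import Literature.AlgebraicGeometry.AbelianSchemes.AbelianSchemeDualRingActionEquivariant
import HarnessLib

/-!
# `𝒪`-compatibility of a polarisation (`ι(σ a) ≫ λ = λ ≫ ι(a)^∨`) transports along `𝒪`-equivariant isomorphisms

Topic `Literature/AlgebraicGeometry/AbelianSchemes`, namespace `Literature.AlgebraicGeometry.AbelianSchemes.AbelianSchemeOver.RingAction` (THEOREMS ONLY; no definition,
no named fact, no `sorry`, no `instance`, no notation; base `S` reduced and locally Noetherian, unit hypotheses `hDB`, `hDC`).  Cell `hodgecm-mathlib`, F0/P6 «MOD»,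
sequel to ★ (D1) `AbelianSchemeDualRingAction` ∕ ★ `AbelianSchemeDualRingActionEquivariant` and ★ (λ) `AbelianSchemeHomDescentPolarized`: the KOTTWITZ∕RSZ compatibility
between the action and the polarisation («`λ ∘ ι(σ a) = ι(a)^∨ ∘ λ`», `σ` = complex conjugation on `𝒪_F`, [Kottwitz1992] §5, [RapoportSmithlingZhang2020Diagonal] §3.2) is
preserved when a polarisation is transported along an `𝒪`-equivariant isomorphism `e : C ≅ B` as `λ_C := e ≫ λ_B ≫ e^∨` — e.g. along the ★ recognition iso of a
Serre tensor ∕ isogeny quotient; `--supports stmt-HodgeConjecture-24832`, count-neutral.  HC_CM is proved only modulo the 2 remaining named inputs (hLiu418, h413) until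
rung 0 closes; this file discharges none of them.

## Mathematics

`ι_C(σa) ≫ e ≫ λ_B ≫ e^∨ = e ≫ ι_B(σa) ≫ λ_B ≫ e^∨ = e ≫ λ_B ≫ ι_B(a)^∨ ≫ e^∨ = e ≫ λ_B ≫ e^∨ ≫ ι_C(a)^∨` (equivariance of `e`, compatibility of `λ_B`,
★ `RingAction.dual_i_comp_dualIsogenyOver` for `e`).  `σ : 𝒪 → 𝒪` is an arbitrary map (the consumer takes complex conjugation).

## Contents

* **`comp_transport_eq_of_compatible`** (`ι_C(σ a) ≫ (e ≫ λ_B ≫ e^∨) = (e ≫ λ_B ≫ e^∨) ≫ ι_C^∨(a)`).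

## References
* [Kottwitz1992] R. Kottwitz, JAMS 5 (1992), §5 (p. 390) (compatibility of `ι` and `λ` via the Rosati involution).
* [RapoportSmithlingZhang2020Diagonal] M. Rapoport, B. Smithling, W. Zhang (2020), §3.2.
* [MumfordAV1970] D. Mumford, *Abelian Varieties* (1970), §15 Thm. 1 (p. 143), §20 (Rosati involution).
* Tree: ★ `AbelianSchemeDualRingActionEquivariant`, ★ `AbelianSchemeDualRingAction`, ★ `AbelianSchemeHomDescentPolarized`.
-/

noncomputable section

universe u

open CategoryTheory CategoryTheory.Limits AlgebraicGeometry MonoidalCategory CartesianMonoidalCategory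
open scoped MonObj

namespace Literature.AlgebraicGeometry.AbelianSchemes

namespace AbelianSchemeOver

namespace RingAction

variable {S : Scheme.{u}} [IsReduced S] [IsLocallyNoetherian S] {B C : AbelianSchemeOver S} {O : Type*} [CommRing O]
  (actB : B.RingAction O) (actC : C.RingAction O) (DB : B.DualPair) (DC : C.DualPair)
  (hDB : Nonempty ((Scheme.Modules.pullback (DualPair.unitHatSlice DB)).obj DB.P ≅ SheafOfModules.unit _))
  (hDC : Nonempty ((Scheme.Modules.pullback (DualPair.unitHatSlice DC)).obj DC.P ≅ SheafOfModules.unit _))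
  (e : C.X ≅ B.X) [IsMonHom e.hom] (σ : O → O)

/-- **Transport of the action∕polarisation compatibility**: if `e : C ≅ B` is `𝒪`-equivariant and `λ_B` satisfies `ι_B(σ a) ≫ λ_B = λ_B ≫ ι_B^∨(a)` for all `a`, then
`λ_C := e ≫ λ_B ≫ e^∨` satisfies `ι_C(σ a) ≫ λ_C = λ_C ≫ ι_C^∨(a)`. [cite: Kottwitz1992, §5 (p. 390)] [cite: RapoportSmithlingZhang2020Diagonal, §3.2]
[cite: MumfordAV1970, §15 Thm. 1 (p. 143)] -/
theorem comp_transport_eq_of_compatible (lamB : B.X ⟶ DB.hat.X) (he : ∀ a, actC.i a ≫ e.hom = e.hom ≫ actB.i a)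
    (hlam : ∀ a, actB.i (σ a) ≫ lamB = lamB ≫ (actB.dual DB hDB).i a) (a : O) :
    actC.i (σ a) ≫ (e.hom ≫ lamB ≫ DualPair.dualIsogenyOver e.hom DC DB) =
      (e.hom ≫ lamB ≫ DualPair.dualIsogenyOver e.hom DC DB) ≫ (actC.dual DC hDC).i a := by
  have h1 := dual_i_comp_dualIsogenyOver e.hom DC DB actC actB hDC hDB he a
  -- `(ι_B^∨ a) ≫ e^∨ = e^∨ ≫ ι_C^∨ a`
  calc actC.i (σ a) ≫ (e.hom ≫ lamB ≫ DualPair.dualIsogenyOver e.hom DC DB)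
      = (actC.i (σ a) ≫ e.hom) ≫ lamB ≫ DualPair.dualIsogenyOver e.hom DC DB := by simp only [Category.assoc]
    _ = e.hom ≫ (actB.i (σ a) ≫ lamB) ≫ DualPair.dualIsogenyOver e.hom DC DB := by rw [he (σ a)]; simp only [Category.assoc]
    _ = e.hom ≫ lamB ≫ ((actB.dual DB hDB).i a ≫ DualPair.dualIsogenyOver e.hom DC DB) := by rw [hlam a]; simp only [Category.assoc]
    _ = (e.hom ≫ lamB ≫ DualPair.dualIsogenyOver e.hom DC DB) ≫ (actC.dual DC hDC).i a := by rw [h1]; simp only [Category.assoc]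

end RingAction

end AbelianSchemeOver

end Literature.AlgebraicGeometry.AbelianSchemes

end
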